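import Mathlib
import HarnessLib
import HarnessLib.Audit.Tags
/-!
# HodgeLocusCensusEmbDimOne — embedding dimension one: the commutative-algebra core of 'F_M EXACT'
(cell pub-hlocus; ivhs-2 (G14-1) FMEXACT-g14.md §2, referee ruling R74(a) step (iii); filed by the lead, gen 13)
HONEST FRAMING: certified instances and evidence bearing on the general Hodge conjecture; no claim.

DICTIONARY. On a row (Λ, λ) of the (8,3,1) slice-germ census (CENSUS-SUMMARY §2 row O8) the first-order excess is
e(Λ, λ) = dim T(V_λ ∩ (X_F + Λ)) = 1 (two kernels, 288/288), so the slice germ has embedding dimension ≤ 1 and its COMPLETE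
local ring is a quotient `K⟦X⟧ ⧸ I` of the formal power series ring in one variable (Cohen structure theorem; the analytic ring
ℂ{u} of the referee's text is likewise a discrete valuation ring with the same two properties, and completion is faithful on
ideals — Mathlib has the formal ring, so the statements below are made for `K⟦X⟧`, K any field).

PROVED here (kernel, no sorry):
* `ideal_eq_bot_or_eq_span_X_pow` — DICHOTOMY: every ideal of `K⟦X⟧` is `⊥` or `(X^n)`; with `span_X_pow_eq_span_X_pow_iff`
  the exponent is unique. Reading: a germ of embedding dimension ≤ 1 is EITHER the smooth curve germ (I = ⊥) OR a fat point
  `K[u]/(u^n)` of a well-defined length n — on e = 1 rows the census's two verdict classes 'C' (smooth curve germ) and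
  'FAT POINT of length ℓ' are EXHAUSTIVE; no third kind of row can occur, whatever the complement.
* `prime_eq_bot_of_ne_maximal`, `ideal_eq_bot_of_le_prime_ne_maximal` — RIGIDITY = R74(a) step (iii): if I lies in a prime
  ideal other than the maximal ideal (the germ contains a closed sub-germ of POSITIVE dimension), then I = ⊥ — the slice germ IS
  the smooth curve germ; and `subgerm_ideal_eq_bot` — the sub-germ's own ideal J ⊇ I satisfies the same hypothesis, so J = ⊥ too:
  the sub-germ equals the whole germ AS A SCHEME, hence is itself smooth and reduced. As the referee recorded, the equality
  'V_λ ∩ (F+Λ) = F_M(λ) ∩ (F+Λ)' therefore uses ONLY e = 1 and the existence of a positive-dimensional sub-germ; the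
  transversality dφ_λ(0) ≠ 0 of the sixty rows is a consequence, not an input.
* `finrank_quotient_span_X_pow`, `isArtinianRing_quotient_span_X_pow` — LENGTH: `K⟦X⟧ ⧸ (X^n)` is `K^n` as a vector space
  (`nonempty_quotient_span_X_pow_equiv`: by the first n coefficients), hence Artinian: 'FAT POINT of length n' = the quotient by (u^n),
  its length is its K-dimension, and `embDimOne_curve_or_fatPoint` is the census form of the dichotomy.
* `X_pow_mem_span_X_pow_iff`, `span_X_pow_eq_span_X_pow_iff` — bookkeeping (uniqueness of the length).

NOT formalised (cited evidence: COMPONENTS.md (G14-1)–(G14-3), REFEREE.md R74, CENSUS-SUMMARY §0 TWELFTH ADDENDUM): the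
Hodge-theoretic steps (i) cone correspondence c_h, (ii) one period equation on cubic fourfolds (h^{3,1} = 1), (iv) Zucker 1977;
Cohen's structure theorem; and the engines' finite computations (e = 1; dim Λ'_M = 2). Characteristic-free.
-/

namespace Summit.HodgeConjecture.HodgeConjecture.HodgeLocus.Census

open PowerSeries IsLocalRing

section EmbDimOne
variable {K : Type*} [Field K]

/-- DICHOTOMY: an ideal of `K⟦X⟧` is `⊥` (smooth curve germ) or `(X^n)` (fat point of length `n`). -/
theorem ideal_eq_bot_or_eq_span_X_pow (I : Ideal K⟦X⟧) :
    I = ⊥ ∨ ∃ n : ℕ, I = Ideal.span {(X : K⟦X⟧) ^ n} := by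
  by_cases h : I = ⊥
  · exact Or.inl h
  · exact Or.inr (IsDiscreteValuationRing.ideal_eq_span_pow_irreducible h X_irreducible)

/-- `X^m ∈ (X^n) ↔ n ≤ m` in `K⟦X⟧`. -/
theorem X_pow_mem_span_X_pow_iff (m n : ℕ) :
    (X : K⟦X⟧) ^ m ∈ Ideal.span {(X : K⟦X⟧) ^ n} ↔ n ≤ m := by
  rw [Ideal.mem_span_singleton]
  exact pow_dvd_pow_iff X_ne_zero X_irreducible.not_isUnit

/-- the length of the fat point is well defined: `(X^n) = (X^m) ↔ n = m`. -/
theorem span_X_pow_eq_span_X_pow_iff (n m : ℕ) :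
    Ideal.span {(X : K⟦X⟧) ^ n} = Ideal.span {(X : K⟦X⟧) ^ m} ↔ n = m := by
  constructor
  · intro h
    have h1 : (X : K⟦X⟧) ^ n ∈ Ideal.span {(X : K⟦X⟧) ^ m} := h ▸ Ideal.mem_span_singleton_self _
    have h2 : (X : K⟦X⟧) ^ m ∈ Ideal.span {(X : K⟦X⟧) ^ n} := h.symm ▸ Ideal.mem_span_singleton_self _
    rw [X_pow_mem_span_X_pow_iff] at h1 h2
    omega
  · rintro rfl; rfl

/-- the fat point `(X^n)`, `n ≥ 1`, is a genuine point: `(X^n) ≠ ⊥` and `(X^n) ≠ ⊤`. -/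
theorem span_X_pow_ne_bot_ne_top (n : ℕ) (hn : 1 ≤ n) :
    Ideal.span {(X : K⟦X⟧) ^ n} ≠ ⊥ ∧ Ideal.span {(X : K⟦X⟧) ^ n} ≠ ⊤ := by
  refine ⟨?_, ?_⟩
  · rw [Ne, Ideal.span_singleton_eq_bot]; exact pow_ne_zero _ X_ne_zero
  · rw [Ne, Ideal.span_singleton_eq_top]; exact (X_irreducible.not_isUnit) ∘ (isUnit_pow_iff (by omega)).mp

/-- In `K⟦X⟧` the only prime ideal other than the maximal ideal `(X)` is `⊥`
(the curve germ has exactly two points: the closed point and the generic point). -/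
theorem prime_eq_bot_of_ne_maximal {P : Ideal K⟦X⟧} (hP : P.IsPrime) (hne : P ≠ maximalIdeal K⟦X⟧) :
    P = ⊥ := by
  by_contra hbot
  exact hne (IsLocalRing.eq_maximalIdeal (hP.isMaximal hbot))

/-- RIGIDITY (referee R74(a), step (iii)): an ideal contained in a non-maximal prime — i.e. the germ `Spf K⟦X⟧ ⧸ I` contains a
closed sub-germ of positive dimension — is `⊥`: the germ is the whole smooth curve germ. -/
theorem ideal_eq_bot_of_le_prime_ne_maximal {I P : Ideal K⟦X⟧} (hP : P.IsPrime)
    (hne : P ≠ maximalIdeal K⟦X⟧) (hIP : I ≤ P) : I = ⊥ :=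
  le_bot_iff.mp (prime_eq_bot_of_ne_maximal hP hne ▸ hIP)

/-- … and the sub-germ is the whole germ AS A SCHEME: if `I ≤ J ≤ P` with `P` a non-maximal prime (J = the ideal of the
positive-dimensional sub-germ, e.g. the zero scheme of the one period equation of F_M(λ)), then `J = ⊥ = I`. In particular the
sub-germ is smooth and reduced without any transversality input. -/
theorem subgerm_ideal_eq_bot {I J P : Ideal K⟦X⟧} (hP : P.IsPrime) (hne : P ≠ maximalIdeal K⟦X⟧)
    (hIJ : I ≤ J) (hJP : J ≤ P) : J = ⊥ ∧ I = ⊥ :=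
  ⟨ideal_eq_bot_of_le_prime_ne_maximal hP hne hJP, ideal_eq_bot_of_le_prime_ne_maximal hP hne (hIJ.trans hJP)⟩

/-- Contrapositive in census language: a FAT POINT row (I = (X^n), n ≥ 1) contains no positive-dimensional sub-germ —
every prime ideal containing `(X^n)` is the maximal ideal. -/
theorem fatPoint_primes_eq_maximal (n : ℕ) (hn : 1 ≤ n) {P : Ideal K⟦X⟧} (hP : P.IsPrime)
    (hle : Ideal.span {(X : K⟦X⟧) ^ n} ≤ P) : P = maximalIdeal K⟦X⟧ := by
  by_contra hne
  exact (span_X_pow_ne_bot_ne_top n hn).1 (ideal_eq_bot_of_le_prime_ne_maximal hP hne hle)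

/-- The dichotomy restated on the germ: either `I = ⊥` (smooth curve germ: `K⟦X⟧ ⧸ I ≃ K⟦X⟧`), or the germ is a fat point —
`I = (X^n)` with `n ≥ 1` unique and every prime of the germ is the closed point. (`I = ⊤`, the empty germ, is `n = 0`.) -/
theorem embDimOne_dichotomy (I : Ideal K⟦X⟧) (hI : I ≠ ⊤) :
    I = ⊥ ∨ ∃! n : ℕ, 1 ≤ n ∧ I = Ideal.span {(X : K⟦X⟧) ^ n} := by
  rcases ideal_eq_bot_or_eq_span_X_pow I with h | ⟨n, hn⟩
  · exact Or.inl h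
  · right
    refine ⟨n, ⟨?_, hn⟩, ?_⟩
    · rcases Nat.eq_zero_or_pos n with h0 | h0
      · exact absurd (by simpa [h0] using hn) hI
      · exact h0
    · rintro m ⟨-, hm⟩
      exact (span_X_pow_eq_span_X_pow_iff m n).mp (hm.symm.trans hn)

end EmbDimOne

section Length
variable {K : Type*} [Field K]

/-- the 'first `n` coefficients' map `K⟦X⟧ → K^n` (`LinearMap.pi` of the coefficient functionals) is surjective:
every coefficient vector below degree `n` is realised. (Stated on the term itself: no auxiliary definition is introduced.) -/
theorem coeffBelow_surjective (n : ℕ) :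
    Function.Surjective (LinearMap.pi fun i : Fin n => PowerSeries.coeff (R := K) (i : ℕ)) := by
  intro v
  refine ⟨PowerSeries.mk fun m => if h : m < n then v ⟨m, h⟩ else 0, ?_⟩
  funext i
  simp [LinearMap.pi_apply, coeff_mk, i.is_lt]

/-- … and its kernel is exactly the ideal `(X^n)` (as a `K`-subspace). -/
theorem ker_coeffBelow (n : ℕ) :
    LinearMap.ker (LinearMap.pi fun i : Fin n => PowerSeries.coeff (R := K) (i : ℕ)) =
      (Ideal.span {(X : K⟦X⟧) ^ n}).restrictScalars K := by
  ext φ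
  simp only [LinearMap.mem_ker, Submodule.restrictScalars_mem, Ideal.mem_span_singleton, X_pow_dvd_iff]
  constructor
  · intro h m hm
    have := congr_fun h ⟨m, hm⟩
    simpa [LinearMap.pi_apply] using this
  · intro h
    funext i
    simpa [LinearMap.pi_apply] using h i i.is_lt

/-- the fat point `K⟦X⟧ ⧸ (X^n)` as a `K`-vector space is `K^n` (an explicit equivalence by the first `n` coefficients exists) -/
theorem nonempty_quotient_span_X_pow_equiv (n : ℕ) :
    Nonempty ((K⟦X⟧ ⧸ Ideal.span {(X : K⟦X⟧) ^ n}) ≃ₗ[K] (Fin n → K)) :=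
  ⟨(Submodule.Quotient.restrictScalarsEquiv K (Ideal.span {(X : K⟦X⟧) ^ n})).symm.trans
    ((Submodule.quotEquivOfEq _ _ (ker_coeffBelow n).symm).trans
      (LinearMap.quotKerEquivOfSurjective _ (coeffBelow_surjective n)))⟩

/-- LENGTH: the fat point `K⟦X⟧ ⧸ (X^n)` has `K`-dimension exactly `n` — the census's 'FAT POINT of length n'
(Hilbert–Samuel function 1, 2, …, n, n, n, …) is the quotient by `(u^n)` and nothing else. -/
theorem finrank_quotient_span_X_pow (n : ℕ) :
    Module.finrank K (K⟦X⟧ ⧸ Ideal.span {(X : K⟦X⟧) ^ n}) = n := by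
  obtain ⟨e⟩ := nonempty_quotient_span_X_pow_equiv (K := K) n
  rw [e.finrank_eq, Module.finrank_fin_fun]

/-- the fat point `K⟦X⟧ ⧸ (X^n)` is a finite-dimensional `K`-algebra -/
theorem finite_quotient_span_X_pow (n : ℕ) :
    Module.Finite K (K⟦X⟧ ⧸ Ideal.span {(X : K⟦X⟧) ^ n}) := by
  obtain ⟨e⟩ := nonempty_quotient_span_X_pow_equiv (K := K) n
  exact Module.Finite.equiv e.symm

/-- … hence a fat-point row is an ARTINIAN germ (a zero-dimensional scheme supported at the closed point). -/
theorem isArtinianRing_quotient_span_X_pow (n : ℕ) :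
    IsArtinianRing (K⟦X⟧ ⧸ Ideal.span {(X : K⟦X⟧) ^ n}) :=
  haveI := finite_quotient_span_X_pow (K := K) n
  IsArtinianRing.of_finite K _

/-- SUMMARY (census form). For an ideal `I ≠ ⊤` of `K⟦X⟧` exactly one of: (curve) `I = ⊥`; (fat point) `K⟦X⟧ ⧸ I` is a
finite-dimensional `K`-algebra, of dimension `n ≥ 1` with `I = (X^n)`. -/
theorem embDimOne_curve_or_fatPoint (I : Ideal K⟦X⟧) (hI : I ≠ ⊤) :
    I = ⊥ ∨ ∃ n : ℕ, 1 ≤ n ∧ I = Ideal.span {(X : K⟦X⟧) ^ n} ∧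
      Module.finrank K (K⟦X⟧ ⧸ Ideal.span {(X : K⟦X⟧) ^ n}) = n := by
  rcases embDimOne_dichotomy I hI with h | ⟨n, ⟨hn, hIn⟩, -⟩
  · exact Or.inl h
  · exact Or.inr ⟨n, hn, hIn, finrank_quotient_span_X_pow n⟩

/-- CENSUS ANCHORS (row O8 of CENSUS-SUMMARY §2, cell (8,3,1)): the three fat-point lengths of record 4, 7, 10 are the
`ℚ`-dimensions of `ℚ⟦u⟧/(u^4)`, `ℚ⟦u⟧/(u^7)`, `ℚ⟦u⟧/(u^10)` — the only Artinian germs of embedding dimension one with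
Hilbert–Samuel functions (1,2,3,4,4,…), (1,…,7,7,…), (1,…,10,10,…). -/
theorem census831_fatPoint_lengths :
    Module.finrank ℚ (ℚ⟦X⟧ ⧸ Ideal.span {(X : ℚ⟦X⟧) ^ 4}) = 4 ∧
    Module.finrank ℚ (ℚ⟦X⟧ ⧸ Ideal.span {(X : ℚ⟦X⟧) ^ 7}) = 7 ∧
    Module.finrank ℚ (ℚ⟦X⟧ ⧸ Ideal.span {(X : ℚ⟦X⟧) ^ 10}) = 10 :=
  ⟨finrank_quotient_span_X_pow 4, finrank_quotient_span_X_pow 7, finrank_quotient_span_X_pow 10⟩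

end Length

end Summit.HodgeConjecture.HodgeConjecture.HodgeLocus.Census
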